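/-
FILING NOTE (R-H ROUND 1, director-abc W13 (A), row 26 «ltail»; typer of record for this filing: abc-iut-rh-typ-1 gen 2, pair rh-tst-6 g2,
referee rh-ref-2).  Everything down to `end`-of-§«Numeric sanity» is the AUTHOR's file — seat abc-iut-lens-negation-3,
`staging/RH/lens-negation-3/HStar-ltail.lean` sha16 1b068b2f9413cde9 — VERBATIM; §T at the end is the typer's block (column decider
`limitCell_iff_mul` = rh-num-1's k1 recipe as the typed cell; the two hand-checked interior packets of the author's own pre-registered
kill-test (i); the differing cells vs rows 3 and 8 asked for by abc-iut-rh-lead g0).  ROUND-1 word of record (lead 19:01:00Z, confirmed by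
ref-2 19:23:24Z, tst-11 g3 19:23:13Z, this seat 19:3xZ): KILL(k2 ∧ k1) on the author's own kill-test — the decl is filed so that the row's
evidence column cites ONE tree name.  Nothing here asserts abc proved or refuted; no side on [IUTchIII] Cor. 3.12 or on any author.
-/
import Summits.ABC.IUTFork.Cor312LicenceTameExactGenuineK
import Literature.IUT.LogVolume.DifferentEstimatesCorollaries
import HarnessLib

/-!
# R-H CANDIDATE H⋆ «l-TAIL LIMIT CELL» (lens NEGATION, seat abc-iut-lens-negation-3) — SKETCH, folder/staging only

[R-H candidate, hypothesis — not a fact.]  CANDIDATE repair hypothesis, NOT asserted; typed ≠ proved ≠ endorsed; no side taken on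
[IUTchIII] Cor. 3.12 or on any author; nothing here asserts `abc` proved or refuted.  Inputs ⊆ the frozen FACT-LIST (nothing consumed:
definitions only).  LEVEL: H (hull-level antecedent `Cor312Vol.PilotKummerCompatHull` at `Thm311.Real.settingPrVolSharp`).

NEGATION CONSTRUCTION (technique: parametrised countermodel family on the l-AXIS — fix the CURVE-SIDE local type
`(p, e(v|p), n_v = ord_v(q_v))` of one bad place and let the admissible prime `l` run; `(P2)`, `(P5)`, `(P6)` of
`Literature.IUT.LogVolume.Cor22` carry no upper bound on `l`).  Along the family the genuine depth is slaved to `l`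
(`2l ∣ e(w|v)·n_v`, so `l ∣ e(w|v)` when `l ∤ n_v`), the q-pilot degree `m_q(w) = X.qPilot w` and `e_w` grow linearly in `l`, and the ONE
quantity that does not move is the curve-side local height `H_v = 2l·m_q(w)/e_w = ord_p(q_v)` (`ord_p(p) = 1`).  At the binding label
`j = l⋆` every cell of the table whose capacity is EXTENSIVE in the label (∝ `j+1` slots of the packet: rows 3, 5, 8, 15, 16, 18, 20 of
RH-CANDIDATES v1.5, and print's explicit-depth container [ED]) reads `H_v·(1 − 3/l) ≤ 4·ϱ(w) + O(1/(l·e_w))` for a row-specific slot radius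
`ϱ`; every SUB-extensive cell (one log-shell: I06⋆ = `Repair.CandInternal11Gap.HQShellOrbitStar`, rows 6, 7, 10) fails for all `l ≥ l₀(p, e(v|p), n_v)`
BY NAME (`Repair.CandInternal2RealStrata.not_mem_topLabel_of_large_l`).  The candidate below is the `l → ∞` LIMIT CELL of print's container in
row-3 currency (`ϱ = d + a + b`, [IUTchIV] Prop. 1.2 radii and Prop. 1.1 different): the sharpest l-FREE statement on the l-tail whose negation the
seat could not model with the table's engines (CARD `staging/RH/lens-negation-3/CARD-ltail.md`).
SOURCE LOCATOR: [IUTchIV] Prop. 1.1 p. 9, Prop. 1.2 (i) p. 10 (radii `a_e`, `b_e`, different order); [IUTchI] Ex. 3.2 (iv) p. 71 (`q̲_v = q_v^{1/2l}`);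
[IUTchIV] Cor. 2.2 (ii) p. 46 ((P2)(P5)(P6): no `l`–height coupling).  [claim: Mochizuki2012, status: disputed]
-/

noncomputable section

open Set Function NumberField IsDedekindDomain
open scoped Pointwise

namespace Summit.ABC.IUTFork.Repair.RH.LTail

open Literature.AnabelianGeometry.AbsoluteAnabelian Literature.IUT.LogThetaLattice Literature.IUT.LogVolume Literature.IUT.HodgeTheaters
open Literature.NumberTheory.NumberFields Literature.NumberTheory.GaloisRepresentations.Ultrametric
open Summit.ABC.IUTFork.Thm311 Summit.ABC.IUTFork.Thm311.Real Summit.ABC.IUTFork.Cor312 Summit.ABC.IUTFork.Cor312.Setting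
  Summit.ABC.IUTFork.Cor312Vol Summit.ABC.IUTFork.Cor312Prov

variable {F K Fbar : Type} [Field F] [NumberField F] [Field K] [NumberField K] [Algebra F K] [Field Fbar]
  [Algebra F Fbar] [Algebra K Fbar] {E : WeierstrassCurve F} [E.IsElliptic] {l : ℕ} {Pb : BadPlacePredicates K}

/-- **Curve-side local height** of the q-parameter under a place `w` of the genuine `K`-datum, in `ord_p` units (`ord_p(p) = 1`):
`H(w) := 2l·m_q(w)/e_w` with `m_q(w) = X.qPilot w` (q-pilot degree, `ord_w` units) and `e_w` the absolute ramification index.  It equals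
`ord_v(q_v)/e(v|p)` for the place `v` of the field of moduli under `w` — invariant under the extension `K/F` and under the choice of `l`
(the l-AXIS invariant of the negation construction). [R-H candidate vocabulary, hypothesis — not a fact] [claim: Mochizuki2012, status: disputed] -/
@[claim "Mochizuki2012" "disputed"]
def locHeight (l : ℕ) (P : ℝ) (e : ℕ) : ℝ := 2 * (l : ℝ) * P / (e : ℝ)

/-- **The l-TAIL LIMIT CELL** in one real currency: `H ≤ 4·(d + a + b)` — the `l → ∞` limit, at the binding label `j = l⋆`, of print's
explicit-depth container condition `(j² − 1)·m_q ≤ (j+1)·e_w·(d + a + b) + …` (row 3 «hull-capacity-necessary» currency; `d` = different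
order, `a`, `b` = [IUTchIV] Prop. 1.2 log-shell radii, all in `ord_p` units).  `l` enters ONLY through `H`, which is `l`-free on genuine data.
[R-H candidate, hypothesis — not a fact] [claim: Mochizuki2012, status: disputed] -/
@[claim "Mochizuki2012" "disputed"]
def LimitCell (l : ℕ) (P : ℝ) (e : ℕ) (d a b : ℝ) : Prop := locHeight l P e ≤ 4 * (d + a + b)

/-- **H⋆_ltail — the l-TAIL LIMIT CELL at every bad place over an odd prime of the genuine `K`-level datum `pilotDataOfK D K`.**
«[R-H candidate, hypothesis — not a fact]» (seat abc-iut-lens-negation-3, lens NEGATION; CARD `staging/RH/lens-negation-3/CARD-ltail.md`).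
No label structure (labels eliminated by the scaling limit), no place cut, no carrier change, no budget; the datum class it carves is
`{every bad w ∤ 2 : H(w) ≤ 4·(d_w + a_w + b_w)}`.  Places over `2` are not claimed (the deep/window locus of the certificate of record
quantifies `pp > 2`). [cite: Mochizuki2012, IUTchIV Prop. 1.1 p. 9, Prop. 1.2 (i) p. 10; IUTchI Ex. 3.2 (iv) p. 71] [claim: Mochizuki2012, status: disputed] -/
@[claim "Mochizuki2012" "disputed"]
def HStarLTail (D : InitialThetaData F K Fbar E l Pb) : Prop :=
  ∀ (pp : Nat.Primes) (w : (thetaIndex (pilotDataOfK D K)).Fibre (.inr pp)),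
    haveI : Fact (pp : ℕ).Prime := ⟨pp.2⟩
    placeOf (pilotDataOfK D K) pp.1 w ∈ (pilotDataOfK D K).S → 2 < (pp : ℕ) →
      LimitCell (pilotDataOfK D K).l ((pilotDataOfK D K).qPilot (placeOf (pilotDataOfK D K) pp.1 w))
        (absRamificationIdx (pp : ℕ) (kOf (pilotDataOfK D K) pp.1 w))
        (differentOrd (pp : ℕ) (kOf (pilotDataOfK D K) pp.1 w))
        (logRadiusA (pp : ℕ) (absRamificationIdx (pp : ℕ) (kOf (pilotDataOfK D K) pp.1 w)))
        (logRadiusB (pp : ℕ) (absRamificationIdx (pp : ℕ) (kOf (pilotDataOfK D K) pp.1 w)))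

/-- **H⋆_ltail, LABELLED (finite-`l`) FORM** — the same slot radius demanded at every label `j = i+1 ≤ l⋆` with the packet's `j+1` slots:
`(j² − 1)·m_q(w) ≤ (j+1)·e_w·(d_w + a_w + b_w)`.  At the binding label it is the limit cell up to the factor `l/(l−3)`; it is row 3's cell
without its `+1`.  Filed only so that the k1 batch can read the candidate in per-label column vocabulary. [R-H candidate, hypothesis — not a fact]
[claim: Mochizuki2012, status: disputed] -/
@[claim "Mochizuki2012" "disputed"]
def HStarLTailLabelled (D : InitialThetaData F K Fbar E l Pb) : Prop :=
  ∀ (pp : Nat.Primes) (i : Fin (pilotDataOfK D K).lstar) (w : (thetaIndex (pilotDataOfK D K)).Fibre (.inr pp)),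
    haveI : Fact (pp : ℕ).Prime := ⟨pp.2⟩
    placeOf (pilotDataOfK D K) pp.1 w ∈ (pilotDataOfK D K).S → 2 < (pp : ℕ) →
      ((((i : ℕ) : ℝ) + 1) ^ 2 - 1) * (pilotDataOfK D K).qPilot (placeOf (pilotDataOfK D K) pp.1 w)
        ≤ (((i : ℕ) : ℝ) + 2) * (absRamificationIdx (pp : ℕ) (kOf (pilotDataOfK D K) pp.1 w) : ℝ) *
          (differentOrd (pp : ℕ) (kOf (pilotDataOfK D K) pp.1 w)
            + logRadiusA (pp : ℕ) (absRamificationIdx (pp : ℕ) (kOf (pilotDataOfK D K) pp.1 w))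
            + logRadiusB (pp : ℕ) (absRamificationIdx (pp : ℕ) (kOf (pilotDataOfK D K) pp.1 w)))

/-! ## Numeric sanity of the currency (pure arithmetic; NOT table verdicts — k1 is rh-num-1's pen) -/

/-- k4 WITNESS CELL `HEX:1:11@p7.j5.ev15` (`p = 7`, `l = 11`, `e_w = 165`, `m_q = 15`, tame `d = 164/165`, `a = 33/165`, `b = 2 − 1/165`):
the local height is `H = 2·11·15/165 = 2` and the limit cell holds, `2 ≤ 4·(164/165 + 33/165 + 329/165)`, while I06⋆ fails there
(WINDOW-TABLE col `RH_I06star_slack = 164 − 24·30 = −556`; `Repair.CandInternal2RealStrata.not_mem_topLabel_of_large_l`). -/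
example : locHeight 11 15 165 = 2 := by norm_num [locHeight]

example : LimitCell 11 15 165 (164 / 165) (33 / 165) (2 - 1 / 165) := by
  norm_num [LimitCell, locHeight]

/-- NEGATIVE side of the class on the same curve family at `k = 13` (`H = 26`), `l = 73`, `e_w = 1095`, `b = 3 − 1/1095`:
`26 > 4·(1094/1095 + 219/1095 + 3 − 1/1095)` (consistent with R-W FINDING F0-3: `k ≥ 13` refuted at the top label). -/
example : ¬ LimitCell 73 195 1095 (1094 / 1095) (219 / 1095) (3 - 1 / 1095) := by
  norm_num [LimitCell, locHeight]


/-! ## §T. Typer's block (abc-iut-rh-typ-1 g2, pair of row 26): the column decider, the kill-test packets, the differing cells -/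

/-- **k1 decider — the recipe IS the typed cell**: for `e > 0`, `LimitCell n P e d a b ⟺ 2·n·P ≤ 4·e·(d + a + b)` (rh-num-1's per-packet
recipe «POS iff 2·l·m_q ≤ 4·e_w·(d+a+b)», RH-CANDIDATES row 26 col. 7; rh-kit-2 PREREG pass 11 column «26»). [R-H candidate, hypothesis — not a fact] -/
theorem limitCell_iff_mul {n : ℕ} {P : ℝ} {e : ℕ} (he : 0 < e) {d a b : ℝ} :
    LimitCell n P e d a b ↔ 2 * (n : ℝ) * P ≤ 4 * (e : ℝ) * (d + a + b) := by
  unfold LimitCell locHeight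
  have he' : (0 : ℝ) < (e : ℝ) := by exact_mod_cast he
  rw [div_le_iff₀ he', show 4 * (d + a + b) * (e : ℝ) = 4 * (e : ℝ) * (d + a + b) by ring]

/-- **The author's pre-registered kill-test (i), two INTERIOR packets hand-checked against WINDOW-TABLE v4.10** (abc-iut-rh-typ-1 g2, exact
rationals; ref-2 checked a third): frey `2·5¹⁰·13⁴ + 3¹⁵·7·31⁷·45817 = 11⁸·109²` at `l = 109`, `p = 3` (`e_w = 654`, `m_q = 90`, `d = 871/654`,
`a = 1`, `b = 3923/654`: `H = 30 ≤ 3632/109`) and frey `2⁴⁶·23 + 3⁹·5⁵·11⁷·31²·43 = 19¹¹·59·7²` at `l = 43`, `p = 11` (`e_w = 1290`, `m_q = 210`,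
`d = 1289/1290` exact, `a = 24/215`, `b = 3869/1290`: `H = 14 ≤ 10604/645`) are H⋆₂₆-POS — while the licence is REFUTED of record there
(U2-cell kernel iff p460046 + p459071; W-num-6 RAD p454852 + p454022).  Computed ≠ proved; the verdict words are the lead's. -/
example : LimitCell 109 90 654 (871 / 654) 1 (3923 / 654) ∧ LimitCell 43 210 1290 (1289 / 1290) (24 / 215) (3869 / 1290) := by
  constructor <;> norm_num [LimitCell, locHeight]

/-- **DIFFERING CELL vs ROW 3 «hull-capacity-necessary»** at G-HEX-k5-l11-ev3@p7.j5 (WINDOW-TABLE v4.10: `l = 11`, `e_w = 33`, `m_q = 15`,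
`d = 32/33`, `a = 7/33`, `b = 32/33`): H⋆₂₆ NEG (`H = 10 > 4ϱ = 284/33`) while row 3's top-label container cell
`(j²−1)·m_q ≤ (j+1)·e_w·(d+a+b) + 1` is POS (`360 ≤ 427`) — the finite-`l` factor `l/(l−3) = 11/8` (8 such HEX top cells in v4.10). -/
example : ¬ LimitCell 11 15 33 (32 / 33) (7 / 33) (32 / 33) ∧
    ((5 : ℝ) ^ 2 - 1) * 15 ≤ (5 + 1) * (33 : ℝ) * (32 / 33 + 7 / 33 + 32 / 33) + 1 := by
  constructor <;> norm_num [LimitCell, locHeight]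

/-- **DIFFERING CELL vs ROW 8 «heightclass»** at the interior packet above (`l = 109`, `p = 3`, `j = l⋆ = 54`, `e_w = 654`, `m_q = 90`; untied
`r♯ = min_t (3^t − 654·t) = −3195` at `t = 6`): H⋆₂₆ POS while row 8's band cell `(j²−1)·m_q ≤ j·(e_w − r♯) + (1 − r♯)`
(`RHHeightClass.hBand_iff_cells_of_strictMin`, p460197) is NEG (`262350 > 211042`). -/
example : LimitCell 109 90 654 (871 / 654) 1 (3923 / 654) ∧
    ¬ (((54 : ℤ) ^ 2 - 1) * 90 ≤ 54 * (654 - (-3195)) + (1 - (-3195))) := by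
  constructor <;> norm_num [LimitCell, locHeight]

end Summit.ABC.IUTFork.Repair.RH.LTail

end
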